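import Mathlib
import Summits.ValiantsHypothesis.ValiantsHypothesis.Theorems.BarrierLeverPartitionMinorsHitByVPHiddenStatesPathTableStaircase
import Summits.ValiantsHypothesis.ValiantsHypothesis.Theorems.BarrierLeverPartitionMinorsHitByVPHiddenStatesPathTableTransfer
import Summits.ValiantsHypothesis.ValiantsHypothesis.Theorems.BarrierLeverPartitionMinorsHitByVPHiddenStatesPathTablePeel
import Summits.ValiantsHypothesis.ValiantsHypothesis.Theorems.BarrierLeverPartitionMinorsHitByVPHiddenStatesPathTable

/-!
# Route BarrierLever — item `PartitionMinorsHitByVP` (stmt-ValiantsHypothesis-19717), line `hidden-states`: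
# THE PATH TABLE OF `P_k` — THEOREM A: the staircase functional annihilates every row `S ≠ X`, `|S| ≤ k`

Helper file (`--supports stmt-ValiantsHypothesis-19717`; cell valiant-natproofs, 𝒟-side door (c), registered line
`Cruxes/PartitionMinorsHitByVP/Lines/hidden_states.lean` v8; prover seat val-np-p6 gen 16).  Closes NO item; definition-free.
THEOREM A of memo HOME/val-np-p6/g16/MEMO-valnp6-g16.md §3 for the path table `pw k s` and its staircase functional `zk k s`
(`…HiddenStatesPathTable`): ★ `lambda_row_eq_zero` — for every `S` with `|S| ≤ k`, `S ≠ X`: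
`Σ_{φ ∈ maps S} (∏_{a∈S} pw a (φ a)) · zk (S.image φ) = 0`.  Proof: `S ⊆ X`, `S ≠ X` forces the identity map and `|S| < k`;
otherwise peel the top Y-element `a` (`sum_maps_insert`), the inner sum is the local identity `zk_local` (or vanishes by cardinality).

WHAT THIS IS NOT: hypothesis (hA) of `det_ne_zero_of_dual` only; nothing on crux 14610 or VP ≠ VNP.
-/

set_option linter.dupNamespace false

namespace Summit.ValiantsHypothesis.ValiantsHypothesis.Theorems.BarrierLever.HiddenStates

open Finset

noncomputable section

namespace PathTable

variable {k : ℕ} {s : ℂ}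
/-! ## Theorem A: the staircase functional annihilates every row `S ≠ X`, `|S| ≤ k` -/

/-- support: a source map with nonzero weight does not raise Y-values. -/
theorem inl_mem_image_lt {S' : Finset (Fin (k + 1) ⊕ Fin k)} {a : Fin (k + 1)}
    (hmax : ∀ b : Fin (k + 1), Sum.inl b ∈ S' → b < a) {φ : Fin (k + 1) ⊕ Fin k → Fin (k + 1) ⊕ Fin k}
    (hw : ∏ x ∈ S', pw k s x (φ x) ≠ 0) : ∀ c : Fin (k + 1), Sum.inl c ∈ S'.image φ → c < a := by
  intro c hc
  obtain ⟨x, hx, hφx⟩ := Finset.mem_image.1 hc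
  have hwx : pw k s x (φ x) ≠ 0 := fun h => hw (Finset.prod_eq_zero hx h)
  rw [hφx] at hwx
  rcases x with b | i
  · have hb := hmax b hx
    simp only [pw] at hwx
    by_cases hcb : c = b
    · rw [hcb]; exact hb
    · rw [if_neg hcb] at hwx
      by_cases h1 : (c : ℕ) + 1 = (b : ℕ)
      · exact lt_trans (Fin.lt_def.2 (by omega)) hb
      · rw [if_neg h1] at hwx; exact (hwx rfl).elim
  · simp [pw] at hwx

/-- support: a source map with nonzero weight fixes X-elements. -/
theorem apply_inr_eq {S : Finset (Fin (k + 1) ⊕ Fin k)} {φ : Fin (k + 1) ⊕ Fin k → Fin (k + 1) ⊕ Fin k}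
    (hw : ∏ x ∈ S, pw k s x (φ x) ≠ 0) {i : Fin k} (hi : Sum.inr i ∈ S) : φ (Sum.inr i) = Sum.inr i := by
  have hwx : pw k s (Sum.inr i) (φ (Sum.inr i)) ≠ 0 := fun h => hw (Finset.prod_eq_zero hi h)
  simp only [pw] at hwx
  by_contra h
  exact hwx (if_neg h)

/-- ★ **THEOREM A** (memo §3): the staircase functional annihilates every row `S` with `|S| ≤ k`, `S ≠ X`:
`Σ_{φ ∈ maps S} wt(φ) · zk (S.image φ) = 0`. -/
theorem lambda_row_eq_zero (S : Finset (Fin (k + 1) ⊕ Fin k)) (hS : S.card ≤ k)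
    (hX : S ≠ (Finset.univ : Finset (Fin k)).image Sum.inr) :
    ∑ φ ∈ Fintype.piFinset (fun a => if a ∈ S then (Finset.univ : Finset (Fin (k + 1) ⊕ Fin k)) else {a}),
      (∏ a ∈ S, pw k s a (φ a)) * zk k s (S.image φ) = 0 := by
  classical
  by_cases hY : S.toLeft = ∅
  · -- `S ⊆ X`, `S ≠ X`: every nonzero-weight map is the identity on `S`, and `|S| < k`
    have hsub : S ⊆ (Finset.univ : Finset (Fin k)).image Sum.inr := by
      intro x hx
      rcases x with b | i
      · exact absurd (Finset.mem_toLeft.2 hx) (by rw [hY]; exact Finset.notMem_empty _)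
      · exact Finset.mem_image.2 ⟨i, Finset.mem_univ _, rfl⟩
    have hcard : S.card < k := by
      have := Finset.card_lt_card (Finset.ssubset_iff_subset_ne.2 ⟨hsub, hX⟩)
      rwa [Finset.card_image_of_injective _ Sum.inr_injective, Finset.card_univ, Fintype.card_fin] at this
    refine Finset.sum_eq_zero fun φ _ => ?_
    by_cases hw : ∏ a ∈ S, pw k s a (φ a) = 0
    · rw [hw, zero_mul]
    · have himg : S.image φ = S := by
        ext x
        constructor
        · rintro hx
          obtain ⟨y, hy, rfl⟩ := Finset.mem_image.1 hx
          obtain ⟨i, -, rfl⟩ := Finset.mem_image.1 (hsub hy)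
          rw [apply_inr_eq hw hy]; exact hy
        · intro hx
          obtain ⟨i, -, rfl⟩ := Finset.mem_image.1 (hsub hx)
          exact Finset.mem_image.2 ⟨Sum.inr i, hx, apply_inr_eq hw hx⟩
      rw [himg, zk_card_ne hcard.ne, mul_zero]
  · -- peel the top Y-element `a`
    have hne : S.toLeft.Nonempty := Finset.nonempty_iff_ne_empty.2 hY
    set a := S.toLeft.max' hne with ha
    have haS : Sum.inl a ∈ S := Finset.mem_toLeft.1 (Finset.max'_mem _ hne)
    set S' := S.erase (Sum.inl a) with hS'
    have haS' : Sum.inl a ∉ S' := Finset.notMem_erase _ _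
    have hSS' : S = insert (Sum.inl a) S' := (Finset.insert_erase haS).symm
    have hmax : ∀ b : Fin (k + 1), Sum.inl b ∈ S' → b < a := by
      intro b hb
      obtain ⟨hne', hbS⟩ := Finset.mem_erase.1 hb
      exact lt_of_le_of_ne (Finset.le_max' _ b (Finset.mem_toLeft.2 hbS)) fun h => hne' (by rw [h])
    have hS'card : S'.card + 1 = S.card := by rw [hS', Finset.card_erase_of_mem haS]; have := Finset.card_pos.2 ⟨_, haS⟩; omega
    rw [hSS', sum_maps_insert (pw k s) (zk k s) haS']
    refine Finset.sum_eq_zero fun φ' hφ' => ?_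
    by_cases hw : ∏ b ∈ S', pw k s b (φ' b) = 0
    · rw [hw, zero_mul]
    · have hlt := inl_mem_image_lt hmax hw
      have hRcard : (S'.image φ').card ≤ S'.card := Finset.card_image_le
      by_cases hR : (S'.image φ').card + 1 = k
      · rw [zk_local hR a hlt, mul_zero]
      · have hsmall : (S'.image φ').card + 1 < k := by omega
        have hinner : ∑ q : Fin (k + 1) ⊕ Fin k, pw k s (Sum.inl a) q * zk k s (insert q (S'.image φ')) = 0 := by
          refine Finset.sum_eq_zero fun q _ => ?_
          rw [zk_card_ne, mul_zero]
          have := Finset.card_insert_le q (S'.image φ')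
          omega
        rw [hinner, mul_zero]


end PathTable

end

end Summit.ValiantsHypothesis.ValiantsHypothesis.Theorems.BarrierLever.HiddenStates
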